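import Summits.QuantumFields.QCD.Theses.HeatSlicedQuarks
import Summits.QuantumFields.QCD.Theorems.HeatSlicedQuarksQuarkLoopCoefficientDefs
import Summits.QuantumFields.QCD.Theorems.HeatSlicedQuarksQuarkLoopCoefficientHeatSeries
import Summits.QuantumFields.QCD.Theorems.HeatSlicedQuarksQuarkLoopCoefficientHeatSeriesB
import Summits.QuantumFields.QCD.Theorems.HeatSlicedQuarksQuarkLoopCoefficientSymmetricGauge
import Summits.QuantumFields.QCD.Theorems.HeatSlicedQuarksQuarkLoopCoefficientHeatLocality
import Summits.QuantumFields.QCD.Theorems.HeatSlicedQuarksQuarkLoopCoefficientTwistedDuhamelAux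
import Summits.QuantumFields.QCD.Theorems.HeatSlicedQuarksQuarkLoopCoefficientSecondOrderExpansionAux

/-!
# The twisted Duhamel formula for the symmetric-gauge heat symbol
(line `Sketch` of crux stmt-QuantumFields-16786, Duhamel layer, part 3)

Variation of constants on `ℤ⁴` with the magnetic-translation twist, ENTRYWISE.  Abstract setting
(`§1–§4`): a phase `Ω` of modulus at most one with the cocycle identity and `Ω(0, w) = 1`, a
range-two kernel `H` with bounded entries, a "heat symbol" `E_τ(y)` with decay `M e^{−|y|₁}` for
`τ ∈ [0,T]`, the right evolution equation `∂_τ E_τ(y) = −Σ_{v ∈ nbr2 y} Ω(v,y) E_τ(v) H(y−v)` and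
`E_0 = δ_0`, and bounded continuous `X, q` on `[0,T]` with `X_0 = 0` and
`∂_s X_s(w) = −Σ_{v ∈ nbr2 0} Ω(v,w) H(v) X_s(w−v) − q_s(w)` on `(0,T)`.  For
`G(r) = Σ_y Ω(y,w) (E_{t−r}(y) X_r(w−y))_{αβ}` one has `G(t) = X_t(w)_{αβ}`, `G(0) = 0` and
`G'(r) = −Σ_y Ω(y,w) (E_{t−r}(y) q_r(w−y))_{αβ}` on `(0,t)`: the two `H`-terms of the product rule are
`((E⋆H)⋆X)(w)` and `(E⋆(H⋆X))(w)`, equal by the twisted associativity of the Aux file; termwise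
differentiation and continuity of the `y`-series are dominated by `K e^{−|y|₁}`
(`hasDerivAt_tsum_of_isPreconnected`, `continuousOn_tsum`), and the fundamental theorem of calculus
gives `X_t(w)_{αβ} = −∫₀ᵗ Σ_y Ω(y,w) (E_{t−s}(y) q_s(w−y))_{αβ} ds`.

`§5` instantiates with `Ω_θ(v,w) = e^{(iθ/2) v∧w}`, `H = ȟ_θ = sqKer (symLink θ) 0`,
`E = symHeat θ` (decay from the locality bound `stub_heatLocality` with `λ = 1`, evolution equation
`hasDerivAt_symHeat_right`, `heatKer_zero`; `gaussProfile_le_one` from the SecondOrderExpansion toolkit):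
the registered aux stub `stub_twistedDuhamel`.
-/

noncomputable section

namespace Summit.QuantumFields.QCD.Cruxes.QuarkLoopCoefficient.Sketch

open Literature.MathematicalPhysics.QuantumLattice Literature.MathematicalPhysics.QuantumFieldTheory
open Literature.Probability.LatticeModels (Site TorusSite)
open Summit.QuantumFields.QCD.Theorems.QuarkLoopCoefficient
open Summit.QuantumFields.QCD.Cruxes.QuarkLoopCoefficient.Sketch.HeatSeries
open Summit.QuantumFields.QCD.Cruxes.QuarkLoopCoefficient.Sketch.SymmetricGauge
open Summit.QuantumFields.QCD.Cruxes.QuarkLoopCoefficient.Sketch.HeatLocality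
open scoped Matrix ComplexConjugate

namespace TwistedDuhamel

variable (Ω : Site 4 → Site 4 → ℂ) (H : Site 4 → Spin) (E X q : ℝ → Site 4 → Spin)

/-! ## §1 The summand `Ω(y,w) (E_{t−r}(y) X_r(w−y))_{αβ}` and its derivative -/

/-- Product rule for one summand of `G(r) = Σ_y Ω(y,w) (E_{t−r}(y) X_r(w−y))_{αβ}` on `(0,T)`:
`d/dr = Ω(y,w) [((E_{t−r}⋆H)(y) X_r(w−y))_{αβ} − (E_{t−r}(y) (H⋆X_r)(w−y))_{αβ} − (E_{t−r}(y) q_r(w−y))_{αβ}]`. -/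
theorem hasDerivAt_summand {T : ℝ}
    (hEd : ∀ (τ : ℝ) (y : Site 4) (α β : Fin 4), HasDerivAt (fun s => E s y α β)
      (-(∑ v ∈ nbr2 y, Ω v y • (E τ v * H (y - v))) α β) τ)
    (hXd : ∀ s ∈ Set.Ioo 0 T, ∀ (w : Site 4) (α β : Fin 4), HasDerivAt (fun r => X r w α β)
      ((-(∑ v ∈ nbr2 0, Ω v w • (H v * X s (w - v))) - q s w) α β) s)
    (t : ℝ) (w y : Site 4) (α β : Fin 4) {r : ℝ} (hr : r ∈ Set.Ioo 0 T) :
    HasDerivAt (fun r => Ω y w * (E (t - r) y * X r (w - y)) α β)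
      (Ω y w * ((∑ v ∈ nbr2 y, Ω v y • (E (t - r) v * H (y - v))) * X r (w - y)) α β -
        Ω y w * (E (t - r) y * (∑ v ∈ nbr2 0, Ω v (w - y) • (H v * X r (w - y - v)))) α β -
        Ω y w * (E (t - r) y * q r (w - y)) α β) r := by
  have h1 : ∀ γ : Fin 4, HasDerivAt (fun r => E (t - r) y α γ)
      ((∑ v ∈ nbr2 y, Ω v y • (E (t - r) v * H (y - v))) α γ) r := by
    intro γ
    have h := HasDerivAt.comp_const_sub t r (hEd (t - r) y α γ)
    exact h.congr_deriv (neg_neg _)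
  have h3 : HasDerivAt (fun r => ∑ γ, E (t - r) y α γ * X r (w - y) γ β)
      (∑ γ, ((∑ v ∈ nbr2 y, Ω v y • (E (t - r) v * H (y - v))) α γ * X r (w - y) γ β +
        E (t - r) y α γ * ((-(∑ v ∈ nbr2 0, Ω v (w - y) • (H v * X r (w - y - v)))) -
          q r (w - y)) γ β)) r :=
    HasDerivAt.fun_sum fun γ _ => (h1 γ).mul (hXd r hr (w - y) γ β)
  have hfun : (fun r => Ω y w * (E (t - r) y * X r (w - y)) α β) =
      fun r => Ω y w * ∑ γ, E (t - r) y α γ * X r (w - y) γ β := by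
    funext r'
    rw [Matrix.mul_apply]
  rw [hfun]
  refine (h3.const_mul (Ω y w)).congr_deriv ?_
  simp only [Matrix.mul_apply, Matrix.sub_apply, Matrix.neg_apply, Finset.sum_add_distrib, mul_add,
    mul_sub, mul_neg, Finset.sum_sub_distrib, Finset.sum_neg_distrib]
  ring

/-! ## §2 Termwise differentiation of `G` -/

/-- **Derivative of `G`** on `(0,t)`, `t ≤ T`:
`G'(s) = −Σ_y Ω(y,w) (E_{t−s}(y) q_s(w−y))_{αβ}`.  Termwise differentiation
(`hasDerivAt_tsum_of_isPreconnected` on `(0,t)`, derivatives dominated by `K e^{−|y|₁}`), then the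
two `H`-terms cancel by the twisted associativity `twisted_assoc`. -/
theorem hasDerivAt_tsum_summand {T M B KH : ℝ} (hΩ1 : ∀ v w, ‖Ω v w‖ ≤ 1)
    (hΩc : ∀ y k w, Ω y w * Ω (y - k) y = Ω (y - k) w * Ω k (w - (y - k)))
    (hKH : 0 ≤ KH) (hH : ∀ (v : Site 4) (α β : Fin 4), ‖H v α β‖ ≤ KH) (hM : 0 ≤ M) (hB : 0 ≤ B)
    (hEb : ∀ τ ∈ Set.Icc 0 T, ∀ (y : Site 4) (α β : Fin 4),
      ‖E τ y α β‖ ≤ M * Real.exp (-(∑ μ : Fin 4, |((y μ : ℤ) : ℝ)|)))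
    (hEd : ∀ (τ : ℝ) (y : Site 4) (α β : Fin 4), HasDerivAt (fun s => E s y α β)
      (-(∑ v ∈ nbr2 y, Ω v y • (E τ v * H (y - v))) α β) τ)
    (hXd : ∀ s ∈ Set.Ioo 0 T, ∀ (w : Site 4) (α β : Fin 4), HasDerivAt (fun r => X r w α β)
      ((-(∑ v ∈ nbr2 0, Ω v w • (H v * X s (w - v))) - q s w) α β) s)
    (hXb : ∀ s ∈ Set.Icc 0 T, ∀ (w : Site 4) (α β : Fin 4), ‖X s w α β‖ ≤ B)
    (hqb : ∀ s ∈ Set.Icc 0 T, ∀ (w : Site 4) (α β : Fin 4), ‖q s w α β‖ ≤ B)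
    {t : ℝ} (ht : t ≤ T) (w : Site 4) (α β : Fin 4) {s : ℝ} (hs : s ∈ Set.Ioo 0 t) :
    HasDerivAt (fun r => ∑' y, Ω y w * (E (t - r) y * X r (w - y)) α β)
      (-(∑' y, Ω y w * (E (t - s) y * q s (w - y)) α β)) s := by
  -- time bookkeeping on the interval
  have hIcc : ∀ r ∈ Set.Ioo 0 t, r ∈ Set.Icc 0 T ∧ t - r ∈ Set.Icc 0 T := fun r hr =>
    ⟨⟨hr.1.le, (hr.2.trans_le ht).le⟩, ⟨by linarith [hr.2], by linarith [hr.1, ht]⟩⟩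
  -- derivative of each summand
  have hderiv : ∀ (y : Site 4), ∀ r ∈ Set.Ioo 0 t,
      HasDerivAt (fun r => Ω y w * (E (t - r) y * X r (w - y)) α β)
        (Ω y w * ((∑ v ∈ nbr2 y, Ω v y • (E (t - r) v * H (y - v))) * X r (w - y)) α β -
          Ω y w * (E (t - r) y * (∑ v ∈ nbr2 0, Ω v (w - y) • (H v * X r (w - y - v)))) α β -
          Ω y w * (E (t - r) y * q r (w - y)) α β) r := fun y r hr =>
    hasDerivAt_summand Ω H E X q hEd hXd t w y α β ⟨hr.1, hr.2.trans_le ht⟩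
  -- uniform summable bound of the derivatives
  set K : ℝ := 4 * (81 * (4 * (M * Real.exp 2 * KH)) * B) + 4 * (M * (81 * (4 * (KH * B)))) +
    4 * (M * B) with hK
  have hbound : ∀ (y : Site 4), ∀ r ∈ Set.Ioo 0 t,
      ‖Ω y w * ((∑ v ∈ nbr2 y, Ω v y • (E (t - r) v * H (y - v))) * X r (w - y)) α β -
          Ω y w * (E (t - r) y * (∑ v ∈ nbr2 0, Ω v (w - y) • (H v * X r (w - y - v)))) α β -
          Ω y w * (E (t - r) y * q r (w - y)) α β‖ ≤
        K * Real.exp (-(∑ μ : Fin 4, |((y μ : ℤ) : ℝ)|)) := by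
    intro y r hr
    obtain ⟨hr1, hr2⟩ := hIcc r hr
    have na := norm_left_term_le Ω H hΩ1 hKH hH hM (hEb (t - r) hr2) (hXb r hr1) w y (w - y) α β
    have nb := norm_right_term_le Ω H hΩ1 hKH hH hB (hEb (t - r) hr2) (hXb r hr1) w y (w - y) α β
    have nc := norm_phase_term_le Ω hΩ1 (hEb (t - r) hr2) (hqb r hr1) w y (w - y) α β
    refine ((norm_sub_le _ _).trans (add_le_add ((norm_sub_le _ _).trans (add_le_add na nb))
      nc)).trans (le_of_eq ?_)
    rw [hK]
    ring
  -- summability at the base point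
  obtain ⟨hs1, hs2⟩ := hIcc s hs
  have hsum0 : Summable fun y => Ω y w * (E (t - s) y * X s (w - y)) α β :=
    summable_of_le_exp (4 * (M * B)) fun y =>
      (norm_phase_term_le Ω hΩ1 (hEb (t - s) hs2) (hXb s hs1) w y (w - y) α β).trans
        (le_of_eq (by ring))
  have key := hasDerivAt_tsum_of_isPreconnected (summable_exp_neg_l1.mul_left K) isOpen_Ioo
    isPreconnected_Ioo hderiv hbound hs hsum0 hs
  -- evaluate the derivative series: the two `H`-terms cancel by twisted associativity
  have sa : Summable fun y =>
      Ω y w * ((∑ v ∈ nbr2 y, Ω v y • (E (t - s) v * H (y - v))) * X s (w - y)) α β :=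
    summable_of_le_exp (4 * (81 * (4 * (M * Real.exp 2 * KH)) * B)) fun y =>
      (norm_left_term_le Ω H hΩ1 hKH hH hM (hEb (t - s) hs2) (hXb s hs1) w y (w - y) α β).trans
        (le_of_eq (by ring))
  have sb : Summable fun y =>
      Ω y w * (E (t - s) y * (∑ v ∈ nbr2 0, Ω v (w - y) • (H v * X s (w - y - v)))) α β :=
    summable_of_le_exp (4 * (M * (81 * (4 * (KH * B))))) fun y =>
      (norm_right_term_le Ω H hΩ1 hKH hH hB (hEb (t - s) hs2) (hXb s hs1) w y (w - y) α β).trans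
        (le_of_eq (by ring))
  have sc : Summable fun y => Ω y w * (E (t - s) y * q s (w - y)) α β :=
    summable_of_le_exp (4 * (M * B)) fun y =>
      (norm_phase_term_le Ω hΩ1 (hEb (t - s) hs2) (hqb s hs1) w y (w - y) α β).trans
        (le_of_eq (by ring))
  have hab := twisted_assoc Ω H hΩ1 hΩc hH (hEb (t - s) hs2) (hXb s hs1) w α β
  rw [(sa.sub sb).tsum_sub sc, sa.tsum_sub sb, hab, sub_self, zero_sub] at key
  exact key

/-! ## §3 Continuity of the twisted series on `[0,t]` -/

/-- For `Y` bounded and entrywise continuous on `[0,T]` (`Y = X` or `Y = q`), the series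
`r ↦ Σ_y Ω(y,w) (E_{t−r}(y) Y_r(w−y))_{αβ}` is continuous on `[0,t]`, `t ≤ T`
(`continuousOn_tsum`, domination by `4MB e^{−|y|₁}`). -/
theorem continuousOn_tsum_summand {T M B : ℝ} (hΩ1 : ∀ v w, ‖Ω v w‖ ≤ 1)
    (hEb : ∀ τ ∈ Set.Icc 0 T, ∀ (y : Site 4) (α β : Fin 4),
      ‖E τ y α β‖ ≤ M * Real.exp (-(∑ μ : Fin 4, |((y μ : ℤ) : ℝ)|)))
    (hEd : ∀ (τ : ℝ) (y : Site 4) (α β : Fin 4), HasDerivAt (fun s => E s y α β)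
      (-(∑ v ∈ nbr2 y, Ω v y • (E τ v * H (y - v))) α β) τ)
    (Y : ℝ → Site 4 → Spin)
    (hYc : ∀ (w : Site 4) (α β : Fin 4), ContinuousOn (fun s => Y s w α β) (Set.Icc 0 T))
    (hYb : ∀ s ∈ Set.Icc 0 T, ∀ (w : Site 4) (α β : Fin 4), ‖Y s w α β‖ ≤ B)
    {t : ℝ} (ht : t ≤ T) (w : Site 4) (α β : Fin 4) :
    ContinuousOn (fun r => ∑' y, Ω y w * (E (t - r) y * Y r (w - y)) α β) (Set.Icc 0 t) := by
  have hu : Summable fun y : Site 4 => 4 * (M * B) * Real.exp (-(∑ μ : Fin 4, |((y μ : ℤ) : ℝ)|)) :=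
    summable_exp_neg_l1.mul_left (4 * (M * B))
  refine continuousOn_tsum (fun y => ?_) hu (fun y r hr => ?_)
  · have hE : ∀ γ : Fin 4, Continuous fun r : ℝ => E (t - r) y α γ := fun γ =>
      (continuous_iff_continuousAt.mpr fun τ => (hEd τ y α γ).continuousAt).comp
        (continuous_sub_left t)
    have hsum : ContinuousOn (fun r => Ω y w * ∑ γ, E (t - r) y α γ * Y r (w - y) γ β)
        (Set.Icc 0 t) :=
      continuousOn_const.mul (continuousOn_finsetSum _ fun γ _ =>
        (hE γ).continuousOn.mul ((hYc (w - y) γ β).mono (Set.Icc_subset_Icc le_rfl ht)))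
    exact hsum.congr fun r _ => by rw [Matrix.mul_apply]
  · have hr1 : r ∈ Set.Icc 0 T := ⟨hr.1, hr.2.trans ht⟩
    have hr2 : t - r ∈ Set.Icc 0 T := ⟨by linarith [hr.2], by linarith [hr.1]⟩
    exact (norm_phase_term_le Ω hΩ1 (hEb (t - r) hr2) (hYb r hr1) w y (w - y) α β).trans
      (le_of_eq (by ring))

/-! ## §4 Endpoint values and the abstract Duhamel formula -/

/-- `G(t) = X_t(w)_{αβ}` (`E_0 = δ_0`, `Ω(0,w) = 1`). -/
theorem tsum_summand_self (hΩ0 : ∀ w, Ω 0 w = 1)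
    (hE0 : ∀ y, E 0 y = if (0 : Site 4) = y then 1 else 0) (t : ℝ) (w : Site 4) (α β : Fin 4) :
    ∑' y, Ω y w * (E (t - t) y * X t (w - y)) α β = X t w α β := by
  rw [sub_self, tsum_eq_single 0]
  · rw [hE0, if_pos rfl, Matrix.one_mul, sub_zero, hΩ0, one_mul]
  · intro y hy
    rw [hE0, if_neg (fun h => hy h.symm), Matrix.zero_mul, Matrix.zero_apply, mul_zero]

/-- `G(0) = 0` (`X_0 = 0`). -/
theorem tsum_summand_zero (hX0 : ∀ w, X 0 w = 0) (t : ℝ) (w : Site 4) (α β : Fin 4) :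
    ∑' y, Ω y w * (E (t - 0) y * X 0 (w - y)) α β = 0 := by
  simp [hX0]

/-- **Abstract twisted Duhamel formula**: under the hypotheses of the file header,
`X_t(w)_{αβ} = −∫₀ᵗ (Σ_y Ω(y,w) • (E_{t−s}(y) q_s(w−y)))_{αβ} ds` for `t ∈ [0,T]`
(fundamental theorem of calculus for `G` on `[0,t]`). -/
theorem duhamel_abstract {T M B KH : ℝ} (hΩ1 : ∀ v w, ‖Ω v w‖ ≤ 1)
    (hΩc : ∀ y k w, Ω y w * Ω (y - k) y = Ω (y - k) w * Ω k (w - (y - k)))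
    (hΩ0 : ∀ w, Ω 0 w = 1)
    (hKH : 0 ≤ KH) (hH : ∀ (v : Site 4) (α β : Fin 4), ‖H v α β‖ ≤ KH) (hM : 0 ≤ M) (hB : 0 ≤ B)
    (hEb : ∀ τ ∈ Set.Icc 0 T, ∀ (y : Site 4) (α β : Fin 4),
      ‖E τ y α β‖ ≤ M * Real.exp (-(∑ μ : Fin 4, |((y μ : ℤ) : ℝ)|)))
    (hEd : ∀ (τ : ℝ) (y : Site 4) (α β : Fin 4), HasDerivAt (fun s => E s y α β)
      (-(∑ v ∈ nbr2 y, Ω v y • (E τ v * H (y - v))) α β) τ)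
    (hE0 : ∀ y, E 0 y = if (0 : Site 4) = y then 1 else 0)
    (hX0 : ∀ w, X 0 w = 0)
    (hXc : ∀ (w : Site 4) (α β : Fin 4), ContinuousOn (fun s => X s w α β) (Set.Icc 0 T))
    (hqc : ∀ (w : Site 4) (α β : Fin 4), ContinuousOn (fun s => q s w α β) (Set.Icc 0 T))
    (hXd : ∀ s ∈ Set.Ioo 0 T, ∀ (w : Site 4) (α β : Fin 4), HasDerivAt (fun r => X r w α β)
      ((-(∑ v ∈ nbr2 0, Ω v w • (H v * X s (w - v))) - q s w) α β) s)
    (hXb : ∀ s ∈ Set.Icc 0 T, ∀ (w : Site 4) (α β : Fin 4), ‖X s w α β‖ ≤ B)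
    (hqb : ∀ s ∈ Set.Icc 0 T, ∀ (w : Site 4) (α β : Fin 4), ‖q s w α β‖ ≤ B)
    {t : ℝ} (ht : t ∈ Set.Icc 0 T) (w : Site 4) (α β : Fin 4) :
    X t w α β = -∫ s in (0 : ℝ)..t, (∑' y : Site 4, Ω y w • (E (t - s) y * q s (w - y))) α β := by
  have hG := continuousOn_tsum_summand Ω H E hΩ1 hEb hEd X hXc hXb ht.2 w α β
  have hC := continuousOn_tsum_summand Ω H E hΩ1 hEb hEd q hqc hqb ht.2 w α β
  have hderiv : ∀ s ∈ Set.Ioo 0 t,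
      HasDerivAt (fun r => ∑' y, Ω y w * (E (t - r) y * X r (w - y)) α β)
        (-(∑' y, Ω y w * (E (t - s) y * q s (w - y)) α β)) s := fun s hs =>
    hasDerivAt_tsum_summand Ω H E X q hΩ1 hΩc hKH hH hM hB hEb hEd hXd hXb hqb ht.2 w α β hs
  have hint : IntervalIntegrable (fun s => -(∑' y, Ω y w * (E (t - s) y * q s (w - y)) α β))
      MeasureTheory.volume 0 t := (hC.intervalIntegrable_of_Icc ht.1).neg
  have hftc := intervalIntegral.integral_eq_sub_of_hasDerivAt_of_le ht.1 hG hderiv hint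
  rw [tsum_summand_self Ω E X hΩ0 hE0, tsum_summand_zero Ω E X hX0, sub_zero,
    intervalIntegral.integral_neg] at hftc
  rw [← hftc]
  congr 1
  refine intervalIntegral.integral_congr fun s hs => ?_
  rw [Set.uIcc_of_le ht.1] at hs
  have hs1 : s ∈ Set.Icc 0 T := ⟨hs.1, hs.2.trans ht.2⟩
  have hs2 : t - s ∈ Set.Icc 0 T := ⟨by linarith [hs.2], by linarith [hs.1, ht.2]⟩
  have hsum : ∀ α' β' : Fin 4, Summable fun y => (Ω y w • (E (t - s) y * q s (w - y))) α' β' := by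
    intro α' β'
    refine summable_of_le_exp (4 * (M * B)) fun y => ?_
    rw [Matrix.smul_apply, smul_eq_mul]
    exact (norm_phase_term_le Ω hΩ1 (hEb (t - s) hs2) (hqb s hs1) w y (w - y) α' β').trans
      (le_of_eq (by ring))
  show (∑' y, Ω y w * (E (t - s) y * q s (w - y)) α β) =
    (∑' y, Ω y w • (E (t - s) y * q s (w - y))) α β
  rw [tsum_apply_apply hsum]
  simp only [Matrix.smul_apply, smul_eq_mul]

/-! ## §5 The symmetric gauge: instantiation -/

/-- The cocycle identity of the magnetic phases behind the twisted associativity: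
`Ω(y,w) Ω(y−k,y) = Ω(y−k,w) Ω(k,w−(y−k))`. -/
theorem cexp_wedge_cocycle (θ : ℝ) (y k w : Site 4) :
    Complex.exp (((θ / 2 * (wedge y w : ℤ) : ℝ) : ℂ) * Complex.I) *
        Complex.exp (((θ / 2 * (wedge (y - k) y : ℤ) : ℝ) : ℂ) * Complex.I) =
      Complex.exp (((θ / 2 * (wedge (y - k) w : ℤ) : ℝ) : ℂ) * Complex.I) *
        Complex.exp (((θ / 2 * (wedge k (w - (y - k)) : ℤ) : ℝ) : ℂ) * Complex.I) := by
  rw [← Complex.exp_add, ← Complex.exp_add]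
  congr 1
  simp only [wedge, Pi.sub_apply]
  push_cast
  ring

/-- `Ω(0, w) = 1`. -/
theorem cexp_wedge_zero_left (θ : ℝ) (w : Site 4) :
    Complex.exp (((θ / 2 * (wedge 0 w : ℤ) : ℝ) : ℂ) * Complex.I) = 1 := by
  simp [wedge]

/-- Decay of the symmetric-gauge heat symbol on `[0,T]` from the locality bound (`λ = 1`):
`‖E_τ(y)_{αβ}‖ ≤ exp(e² R T) e^{−|y|₁}`. -/
theorem norm_symHeat_le (θ : ℝ) {T : ℝ} : ∀ τ ∈ Set.Icc 0 T, ∀ (y : Site 4) (α β : Fin 4),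
    ‖symHeat θ τ y α β‖ ≤
      Real.exp (Real.exp 2 * 1679616 * T) * Real.exp (-(∑ μ : Fin 4, |((y μ : ℤ) : ℝ)|)) := by
  intro τ hτ y α β
  have h := norm_heatKer_apply_le_exp (norm_symLink_le θ) zero_le_one τ 0 y α β
  simp only [Pi.zero_apply, sub_zero, one_mul, mul_one, abs_of_nonneg hτ.1] at h
  calc ‖symHeat θ τ y α β‖ = ‖heatKer (symLink θ) τ 0 y α β‖ := rfl
    _ ≤ _ := h
    _ ≤ Real.exp (-(∑ μ : Fin 4, |((y μ : ℤ) : ℝ)|)) * Real.exp (Real.exp 2 * 1679616 * T) :=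
        mul_le_mul_of_nonneg_left (Real.exp_le_exp.mpr
          (mul_le_mul_of_nonneg_left hτ.2 (by positivity))) (Real.exp_pos _).le
    _ = _ := mul_comm _ _

end TwistedDuhamel

/-! ## Registered headline -/

/-- **Twisted Duhamel formula** (aux stub `stub_twistedDuhamel` of crux stmt-QuantumFields-16786,
line `Sketch`): if `X` solves `∂_s X = −ȟ_θ ⋆_θ X − q` entrywise on `(0,T)` with `X_0 = 0`, `X, q`
bounded and entrywise continuous on `[0,T]` (`q` below a Gaussian profile), then
`X_t(w)_{αβ} = −∫₀ᵗ (Σ_y Ω_θ(y,w) • (E_{t−s}(y) q_s(w−y)))_{αβ} ds` with `E = symHeat θ`. -/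
theorem stub_twistedDuhamel :
    ∀ (θ T c B : ℝ), 0 < T → 0 < c → ∀ (X q : ℝ → Site 4 → Spin),
      (∀ w : Site 4, X 0 w = 0) →
      (∀ (w : Site 4) (α β : Fin 4), ContinuousOn (fun s => X s w α β) (Set.Icc 0 T)) →
      (∀ (w : Site 4) (α β : Fin 4), ContinuousOn (fun s => q s w α β) (Set.Icc 0 T)) →
      (∀ s ∈ Set.Ioo 0 T, ∀ (w : Site 4) (α β : Fin 4),
        HasDerivAt (fun r => X r w α β)
          ((-(∑ v ∈ nbr2 0, Complex.exp (((θ / 2 * (wedge v w : ℤ) : ℝ) : ℂ) * Complex.I) •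
              (sqKer (symLink θ) 0 v * X s (w - v))) - q s w) α β) s) →
      (∀ s ∈ Set.Icc 0 T, ∀ (w : Site 4) (α β : Fin 4), ‖X s w α β‖ ≤ B) →
      (∀ s ∈ Set.Icc 0 T, ∀ (w : Site 4) (α β : Fin 4), ‖q s w α β‖ ≤ B * gaussProfile c s w) →
      ∀ t ∈ Set.Icc 0 T, ∀ (w : Site 4) (α β : Fin 4),
        X t w α β = -∫ s in (0 : ℝ)..t, (∑' y : Site 4,
          Complex.exp (((θ / 2 * (wedge y w : ℤ) : ℝ) : ℂ) * Complex.I) •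
            (symHeat θ (t - s) y * q s (w - y))) α β := by
  intro θ T c B hT hc X q hX0 hXc hqc hXd hXb hqb t ht w α β
  have hB : 0 ≤ B := (norm_nonneg _).trans (hXb 0 ⟨le_rfl, hT.le⟩ 0 0 0)
  have hqb' : ∀ s ∈ Set.Icc 0 T, ∀ (w : Site 4) (α β : Fin 4), ‖q s w α β‖ ≤ B :=
    fun s hs w α β => (hqb s hs w α β).trans
      (mul_le_of_le_one_right hB (SecondOrderExpansion.gaussProfile_le_one hc.le hs.1 w))
  exact TwistedDuhamel.duhamel_abstract
    (fun v w => Complex.exp (((θ / 2 * (wedge v w : ℤ) : ℝ) : ℂ) * Complex.I))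
    (sqKer (symLink θ) 0) (symHeat θ) X q
    (fun v w => (norm_cexp_wedge θ v w).le) (TwistedDuhamel.cexp_wedge_cocycle θ)
    (TwistedDuhamel.cexp_wedge_zero_left θ) (by norm_num : (0 : ℝ) ≤ 5184)
    (fun v α β => norm_sqKer_le (norm_symLink_le θ) 0 v α β) (Real.exp_pos _).le hB
    (TwistedDuhamel.norm_symHeat_le θ) (fun τ y α β => hasDerivAt_symHeat_right θ τ y α β)
    (fun y => heatKer_zero (norm_symLink_le θ) 0 y) hX0 hXc hqc hXd hXb hqb' ht w α β

end Summit.QuantumFields.QCD.Cruxes.QuarkLoopCoefficient.Sketch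

end
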